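import Mathlib
import Summits.QuantumFields.YangMills.Theorems.ComplexCouplingChannelContinuumLegGivenGapSplitB
import Summits.QuantumFields.YangMills.Theorems.ParabolicTrajectoryContinuumLimitOnTrajectoryStubOSLegsD_Assembly
import Literature.MathematicalPhysics.QuantumFieldTheory.KallenLehmannPositivity
import HarnessLib

/-!
# Crux `ContinuumLegGivenGap` (stmt-QuantumFields-15828), line `duality-selection-nlo-skewness`: the two-point floor from Källén–Lehmann positivity

Registered stub `stub_twoPointOfKL` of the line's reshape a3-1 (lead `prover-line-stmt-QuantumFields-15828-a3-0`,
2026-08-17): the eventual lattice two-point floor `‖κ₂(F₂)‖ ≥ u > 0` for a non-negative admissible pure pair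
`F₂ = f ⊗ g ∈ ⁰𝒮₂` along a weak-coupling scheme carrying (UUVB), (ND), (UCL), (PVG) and both halves of E1 —
i.e. the registered signature of `stub_twoPointPositivity` — GIVEN the Literature named fact
`KallenLehmannPositivity` (Källén–Lehmann positivity of the truncated two-point Schwinger function of a
non-trivial hermitian scalar OS field; Glimm–Jaffe Thm. 6.2.4, Reed–Simon II Thm. IX.34, via OS E→R).

Proof (compactness, as the line card prescribes): if no floor exists, some subsequence `ψ` has `κ₂(F₂) → 0`
(`Filter.extraction_forall_of_frequently`); route ParabolicTrajectory's one-field inputs ride along the sub-scheme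
(landed `cclgSplit_pt_package_subScheme`: `UVB`, `ARP`, `ND2`, `UCL`, `AsympEuclid`), so its landed limit package
(`exists_limitFunctionals`, `LimitPkg.osData`) produces OS data `T` whose curvature Schwinger functions are the
ultrafilter limits of the canonical distributions — hence `𝔖₂(F₂) = 0`, `𝔖₁ = 0` (exact centring, `Λ_one`) — and which
is non-trivial (`LimitPkg.isNontrivial` from `ND2`); Källén–Lehmann positivity then gives `0 < Re 𝔖₂^T(F₂) = 0`.
-/

noncomputable section

namespace Summit.QuantumFields.YangMills.Cruxes.ContinuumLegGivenGap.DualitySelectionNloSkewness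

open scoped SchwartzMap
open Filter Topology MeasureTheory
open Literature.MathematicalPhysics.QuantumFieldTheory Literature.MathematicalPhysics.QuantumLattice
  Literature.MathematicalPhysics.AQFT Literature.Probability.LatticeModels
open Literature.Barriers.QuantumFields (subScheme)
open Summit.QuantumFields.YangMills.Cruxes.ContinuumLimitOnTrajectory.TwoOrbitSynchronisation
  (curvDistribution UUVB ND2 UCL PolyVolumeGrowth AsympTransl AsympRot LimitPkg exists_limitFunctionals
   zeroExt zeroExt_curv)
open Summit.QuantumFields.YangMills.Theorems.ContinuumLegGivenGap (cclgSplit_pt_package_subScheme)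

/-- **Registered stub `stub_twoPointOfKL`** (line `duality-selection-nlo-skewness`, reshape a3-1): Källén–Lehmann
positivity of every subsequential OS limit upgrades, by compactness, to an EVENTUAL lattice floor for the canonical
two-point functional on a non-negative admissible pure pair. With the named fact discharged this is
`stub_twoPointPositivity` verbatim. [folklore] -/
theorem stub_twoPointOfKL :
    Literature.MathematicalPhysics.QuantumFieldTheory.KallenLehmannPositivity →
    ∀ (G : Type) [Group G] [TopologicalSpace G] [IsTopologicalGroup G] [CompactSpace G]
      [MeasurableSpace G] [BorelSpace G], IsCompactSimpleLieGroup G →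
      ∀ (r : LatticeRep G) (sch : SpeciesScheme (YMSpecies G)),
      Tendsto sch.β atTop atTop → UUVB r sch → ND2 r sch → UCL r sch → PolyVolumeGrowth sch →
      AsympTransl r sch → AsympRot r sch →
      ∀ (f g : SchwartzMap (EuclideanSpace ℝ (Fin 4)) ℂ) (F₂ : SchwartzMap (Fin 2 → EuclideanSpace ℝ (Fin 4)) ℂ),
        IsTensorOf F₂ ![f, g] → IsOffDiagonal F₂ →
        (∀ x : EuclideanSpace ℝ (Fin 4), (f x).im = 0 ∧ 0 ≤ (f x).re ∧ (g x).im = 0 ∧ 0 ≤ (g x).re) →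
        f ≠ 0 → g ≠ 0 →
        ∃ u : ℝ, 0 < u ∧ ∀ᶠ k in atTop, u ≤ ‖curvDistribution r sch k 2 F₂‖ := by
  intro hKL G _ _ _ _ _ _ _hG r sch hAF hUU hND hUCL _hPVG hEUC hROT f g F₂ hF₂ hoff hnn hf hg
  by_contra hcon
  push Not at hcon
  -- (1) no floor ⇒ along some strictly increasing `ψ` the two-point functional tends to `0`
  have hfreq : ∀ n : ℕ, ∃ᶠ k in atTop, ‖curvDistribution r sch k 2 F₂‖ < 1 / ((n : ℝ) + 1) :=
    fun n => hcon (1 / ((n : ℝ) + 1)) (by positivity)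
  obtain ⟨ψ, hψ, hψlt⟩ := Filter.extraction_forall_of_frequently hfreq
  have hlim0 : Tendsto (fun n => curvDistribution r sch (ψ n) 2 F₂) atTop (𝓝 0) := by
    rw [tendsto_zero_iff_norm_tendsto_zero]
    exact squeeze_zero (fun n => norm_nonneg _) (fun n => (hψlt n).le) tendsto_one_div_add_atTop_nhds_zero_nat
  -- (2) route ParabolicTrajectory's one-field inputs along the sub-scheme, and its limit package
  obtain ⟨hUVB2, hARP2, hND2, hUCL2, hE1⟩ :=
    cclgSplit_pt_package_subScheme r sch hAF hUU hND hUCL hEUC hROT ψ hψ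
  obtain ⟨𝒰, h𝒰, s, α, β, hα, Λ, hlim, hbd⟩ := exists_limitFunctionals r (subScheme sch ψ hψ) hUVB2
  let P : LimitPkg r (subScheme sch ψ hψ) := ⟨𝒰, h𝒰, Λ, hlim⟩
  have hα' : ∃ (s : ℕ) (α β : ℝ), 0 ≤ α ∧
      ∀ (p : ℕ) (F : 𝓢((Fin p → EuclideanSpace ℝ (Fin 4)), ℂ)), IsOffDiagonal F →
        ‖P.Λ p F‖ ≤ α * (p.factorial : ℝ) ^ β * schwartzNorm (p * s) F := ⟨s, α, β, hα, hbd⟩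
  -- (3) the OS limit: non-trivial, with vanishing two-point function on `F₂`
  have hNT : (P.osData hα' hE1 hARP2 hUCL2).IsNontrivial r.curvature := P.isNontrivial hND2 _ rfl
  have hΛ2 : P.Λ 2 F₂ = 0 := P.Λ_eq_of_tendsto hoff hlim0
  have h2 : (P.osData hα' hE1 hARP2 hUCL2).schwinger 2 (fun _ => r.curvature) F₂ = 0 := by
    show zeroExt r P.Λ 2 (fun _ => r.curvature) F₂ = 0
    rw [zeroExt_curv, hΛ2]
  have h1 : (P.osData hα' hE1 hARP2 hUCL2).schwinger 1 (fun _ => r.curvature)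
      (SchwartzMap.tensorFin 1 ![f]) = 0 := by
    show zeroExt r P.Λ 1 (fun _ => r.curvature) _ = 0
    rw [zeroExt_curv, P.Λ_one]
  -- (4) Källén–Lehmann positivity of the limit contradicts `𝔖₂(F₂) = 0`
  have hpos := hKL (YMSpecies G) 4 (P.osData hα' hE1 hARP2 hUCL2) r.curvature hNT f g F₂
    (SchwartzMap.tensorFin 1 ![f]) (SchwartzMap.tensorFin 1 ![g]) hF₂ hoff (isTensorOf_tensorFin _)
    (isTensorOf_tensorFin _) hnn hf hg
  rw [h2, h1, zero_mul, sub_zero, Complex.zero_re] at hpos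
  exact lt_irrefl _ hpos

end Summit.QuantumFields.YangMills.Cruxes.ContinuumLegGivenGap.DualitySelectionNloSkewness

end
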